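import Literature.AnabelianGeometry.EtaleTheta.LogDivisorModelTateTowerThetaTwistConstants
import Literature.AnabelianGeometry.EtaleTheta.LogDivisorModelTateTowerKummerTwistLevelAction
import Mathlib.GroupTheory.NoncommCoprod

/-!
# [EtTh] Def. 3.3 (iii): «GRP₃′» ACTS on a Kummer level of the `Ÿ`-skeleton — the 2b(ii) ACTION KNIT
# `Grp 3 thetaShear →* Aut(level m)` (design (β): sign-free levels), every Galois-action law PROVED (class (b))

S. Mochizuki, *The étale theta function …*, Publ. RIMS **45** (2009) [MochizukiEtTh2009], §1 p.13, Prop. 1.4 (ii) p.22, Def. 3.3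
(i)(c)/(ii)/(iii) p.72–74 [cite: MochizukiEtTh2009, Def 3.3 p.73].

CLASS (b) MODEL (abc-iut cell, layer L2; seat abc-iut-L2-t3 (gen 7), the 2b(ii) ACTION KNIT of abc-iut-L2-lead R899, under design
(β) «sign-free levels» of this seat's fork (STATUS 2026-08-27 ≈01:55Z; root-of-unity correction `η = 0`).  Inputs BY NAME, none
restated: abc-iut-L1-t6's shear-semidirect group `TateTowerKummerTwistRShear.Grp 3 thetaShear = K₃ ⋊_{(χ,σ)} (C × ℤ_γ)`
(p481663: `Kum`, `Cst`, `M`, `act`, `red`, `thetaShear(Mat)`), this seat's level actions `kummerAction` (p482960),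
`translAction` / `translAction_conj_kummerAction` / `shearClass` (p484463), `constAction` / `constAut_kummerAut` /
`constAction_mul_translAction_zero` (`…ThetaTwistConstants`), abc-iut-L2-d2's `TateTowerTwist.zmodChar` (p-LevelAction).
At the level `m` (`μ = μ_{M_m} = Multiplicative (ZMod (M m))`, `M m = (m+2)!`) of `TateTowerThetaTwist.model μ`:
* `levelKum m : K₃ →* (ℤ/M_m)³` (the index-`m` classes), `levelChar m : C →* Aut μ_{M_m}` (the cyclotomic character mod `M_m`);
* `kumAct m := kummerAction ∘ levelKum m`, `cstTranslAct m := (constAction ∘ levelChar m) · (translAction 0)` (the two factors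
  COMMUTE at `η = 0`: `MonoidHom.noncommCoprod`);
* `shearClass_eq_red_mulVec` — this seat's `shearClass a` IS abc-iut-L1-t6's reduced matrix `red 3 m (thetaShear a)`;
  `kumAct_act : kumAct (q · k) = cstTranslAct q * kumAct k * (cstTranslAct q)⁻¹` — the semidirect law realised on functions;
* **`levelActFn m : Grp 3 thetaShear →* MulAut (Fn μ_{M_m})`** (`SemidirectProduct.lift`) and
  **`levelAction m : (model μ_{M_m}).GaloisAction (Grp 3 thetaShear)`** — functions by `levelActFn`, log-divisors / cusps /
  components through the translation quotient `Grp → ℤ_γ` by the `Ÿ`-skeleton's `baseAction`; EVERY LAW PROVED;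
  `levelActFn_inl` / `_inr` (the Kummer classes act by `K_{k_m}`, `(c, a)` by `C_{χ_m(c)} ∘ T_a`).
So «GRP₃′» — all three Kummer classes, the constants and the translations — acts on every level of the `Ÿ`-skeleton with cusps
and theta; the 2c tower (levels `m ↦ model μ_{M_m}`, transitions `resFn`) is the sequel.
DEVIATION OF RECORD (design (β), abc-iut-L2-lead gen 7 R922): the torsion sign `(−1)^a` of [EtTh] Prop. 1.4 (ii) (p.248:
`Θ̈(q^{a/2} Ü) = (−1)^a q^{−a²/2} Ü^{−2a} Θ̈(Ü)`; `Θ̈(−Ü) = −Θ̈(Ü)`) is NOT carried by the level translations (`translAut 0`;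
kernel-visible: `levelActFn_transl_theta`); print carries signs inside `O^×_K̈ · η̈^Θ` (Prop. 1.4 (iii)) and the `(l·ℤ × μ₂)`-orbit
classes `η̈^{Θ, l·ℤ×μ₂}` (Def. 2.7 p.267; Cor. 2.8 (i) «up to a root of unity of order l (resp. 1)»); everything the tower is for —
log-divisors, the root law, temperedness, Kummer classes modulo torsion at the §5 junction — is sign-blind, and
`translAut_eq_kummerAut_translAut` (p485381) quantifies the sign-faithful alternative (α) as a Kummer torsion element of
`Θ̈`-class («GRP₃″ twisted product», booked, not built).  HONEST LABEL: a combinatorial design model, NOT the tempered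
fundamental group of a Tate curve; defs + theorems only, no Prop-valued fact, no instance, no notation, no sorry; nothing here
bears on [IUTchIII] Cor. 3.12; no side taken; typed ≠ proved.
-/

noncomputable section

namespace Literature.AnabelianGeometry.EtaleTheta

open CategoryTheory

namespace LogDivisorModel

namespace TateTowerThetaTwist

open TateTowerTheta
open TateTowerKummerTwist (M one_lt_M Cst)
open TateTowerKummerTwistR (KumAdd Kum)
open TateTowerKummerTwistRShear (Grp act red thetaShear thetaShearMat)

variable (m : ℕ)

/-! ## The level-`m` shadows of the Kummer classes and of the constants -/

/-- The index-`m` class triple of a Kummer element: `k ↦ k_m ∈ (ℤ/M_m)³`. [cite: MochizukiEtTh2009, Def 3.3 (ii) p.73] -/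
def levelKum : Kum 3 →* Multiplicative (Fin 3 → ZMod (M m)) :=
  AddMonoidHom.toMultiplicative (Pi.evalAddMonoidHom (fun n : ℕ => Fin 3 → ZMod (M n)) m)

/-- `levelKum m k = k_m`. [cite: MochizukiEtTh2009, Def 3.3 (ii) p.73] -/
@[simp] theorem toAdd_levelKum (k : Kum 3) : Multiplicative.toAdd (levelKum m k) = Multiplicative.toAdd k m := rfl

/-- The cyclotomic character of the constants on the roots of unity of level `m`: `c ↦ (ζ ↦ ζ^{c_m})` (abc-iut-L2-d2's `zmodChar`).
[cite: MochizukiEtTh2009, §1 p.13] -/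
def levelChar : Cst →* MulAut (Multiplicative (ZMod (M m))) :=
  (TateTowerTwist.zmodChar (M m)).comp (Pi.evalMonoidHom (fun n : ℕ => (ZMod (M n))ˣ) m)

/-- `levelChar m c ζ = ζ^{c_m}`. [cite: MochizukiEtTh2009, §1 p.13] -/
@[simp] theorem levelChar_apply (c : Cst) (z : Multiplicative (ZMod (M m))) :
    levelChar m c z = Multiplicative.ofAdd ((c m : ZMod (M m)) * Multiplicative.toAdd z) := rfl

/-- The additive form of the character: multiplication by `c_m`. [cite: MochizukiEtTh2009, §1 p.13] -/
def levelCharAdd (c : Cst) : ZMod (M m) ≃+ ZMod (M m) := AddEquiv.toMultiplicative.symm (levelChar m c)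

/-- `levelCharAdd m c z = c_m · z`. [cite: MochizukiEtTh2009, §1 p.13] -/
@[simp] theorem levelCharAdd_apply (c : Cst) (z : ZMod (M m)) : levelCharAdd m c z = (c m : ZMod (M m)) * z := rfl

/-- The multiplicative form of `levelCharAdd` is `levelChar`. [cite: MochizukiEtTh2009, §1 p.13] -/
theorem toMultiplicative_levelCharAdd (c : Cst) : AddEquiv.toMultiplicative (levelCharAdd m c) = levelChar m c :=
  Equiv.apply_symm_apply _ _

/-! ## The three commuting / twisted pieces of the action on functions -/

/-- The Kummer classes acting on the level-`m` functions through their index-`m` triple. [cite: MochizukiEtTh2009, Def 3.3 p.73] -/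
def kumAct : Kum 3 →* MulAut (Fn (Multiplicative (ZMod (M m)))) := kummerAction.comp (levelKum m)

/-- `kumAct m k = K_{k_m}`. [cite: MochizukiEtTh2009, Def 3.3 p.73] -/
@[simp] theorem kumAct_apply (k : Kum 3) (x : Fn (Multiplicative (ZMod (M m)))) :
    kumAct m k x = kummerAut (Multiplicative.toAdd k m) x := rfl

/-- At `η = 0` the constants and the translations commute on functions (design (β)). [cite: MochizukiEtTh2009, Def 3.3 p.73] -/
theorem commute_constAction_translAction (c : Cst) (a : Multiplicative ℤ) :
    Commute (constAction (levelChar m c)) (translAction (0 : ZMod (M m)) a) := by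
  rw [← toMultiplicative_levelCharAdd]
  exact constAction_mul_translAction_zero (levelCharAdd m c) a

/-- The constants and the translations `C × ℤ_γ` acting on the level-`m` functions: `(c, a) ↦ C_{χ_m(c)} ∘ T_a`.
[cite: MochizukiEtTh2009, Def 3.3 p.73] -/
def cstTranslAct : Cst × Multiplicative ℤ →* MulAut (Fn (Multiplicative (ZMod (M m)))) :=
  MonoidHom.noncommCoprod ((constAction (B := ZMod (M m))).comp (levelChar m)) (translAction (0 : ZMod (M m)))
    fun c a => commute_constAction_translAction m c a

/-- `cstTranslAct m (c, a) = C_{χ_m(c)} * T_a`. [cite: MochizukiEtTh2009, Def 3.3 p.73] -/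
theorem cstTranslAct_apply (q : Cst × Multiplicative ℤ) :
    cstTranslAct m q = constAction (levelChar m q.1) * translAction (0 : ZMod (M m)) q.2 := rfl

/-- **This seat's `shearClass a` IS abc-iut-L1-t6's reduced shear matrix `red 3 m (thetaShear a)` on `(ℤ/M_m)³`.**
[cite: MochizukiEtTh2009, Prop 1.4 p.22] -/
theorem shearClass_eq_red_mulVec (a : ℤ) (κ : Fin 3 → ZMod (M m)) :
    shearClass a κ = Matrix.mulVec (red 3 m (thetaShearMat a)) κ := by
  ext i
  fin_cases i <;>
    (simp [shearClass, Matrix.mulVec, dotProduct, Fin.sum_univ_three, TateTowerKummerTwistRShear.thetaShearMat, zsmul_eq_mul,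
      Matrix.map_apply]; try ring)

/-- The level-`m` triple of `q · k` (`q = (c, a)`): `χ_m(c) · σ̄_a k_m = c_m · shearClass a k_m`. [cite: MochizukiEtTh2009, Prop 1.4 p.22] -/
theorem toAdd_act_level (q : Cst × Multiplicative ℤ) (k : Kum 3) :
    Multiplicative.toAdd (act 3 thetaShear q k) m =
      fun i => levelCharAdd m q.1 (shearClass (Multiplicative.toAdd q.2) (Multiplicative.toAdd k m) i) := by
  rw [TateTowerKummerTwistRShear.toAdd_act_apply, TateTowerKummerTwistRShear.thetaShear_apply, ← shearClass_eq_red_mulVec]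
  rfl

/-- **The semidirect law realised on the functions of the level**: `K_{(q·k)_m} = (C_c T_a) K_{k_m} (C_c T_a)⁻¹`.
[cite: MochizukiEtTh2009, Def 3.3 p.73] -/
theorem kumAct_act (q : Cst × Multiplicative ℤ) (k : Kum 3) :
    kumAct m (act 3 thetaShear q k) = cstTranslAct m q * kumAct m k * (cstTranslAct m q)⁻¹ := by
  refine MulEquiv.ext fun x => ?_
  rw [kumAct_apply, toAdd_act_level, cstTranslAct_apply]
  show _ = constAction (levelChar m q.1) (translAction (0 : ZMod (M m)) q.2 (kummerAut (Multiplicative.toAdd k m)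
    ((translAction (0 : ZMod (M m)) q.2).symm ((constAction (levelChar m q.1)).symm x))))
  rw [← toMultiplicative_levelCharAdd, constAction_apply, translAction_apply]
  show _ = constAut (levelCharAdd m q.1) (translAut 0 (Multiplicative.toAdd q.2) (kummerAut (Multiplicative.toAdd k m)
    ((translAut 0 (Multiplicative.toAdd q.2)).symm ((constAut (levelCharAdd m q.1)).symm x))))
  rw [translAut_kummerAut_symm, constAut_kummerAut, MulEquiv.apply_symm_apply]

/-! ## The knit: «GRP₃′» → Aut(level m) -/

/-- **«GRP₃′» acting on the functions of level `m`**: `⟨k, (c, a)⟩ ↦ K_{k_m} ∘ C_{χ_m(c)} ∘ T_a` — a homomorphism by the semidirect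
law `kumAct_act` (`SemidirectProduct.lift`). [cite: MochizukiEtTh2009, Def 3.3 p.73] -/
def levelActFn : Grp 3 thetaShear →* MulAut (Fn (Multiplicative (ZMod (M m)))) :=
  SemidirectProduct.lift (kumAct m) (cstTranslAct m) fun q => MonoidHom.ext fun k => by
    change kumAct m (act 3 thetaShear q k) = cstTranslAct m q * kumAct m k * (cstTranslAct m q)⁻¹
    exact kumAct_act m q k

/-- A pure Kummer element acts by `K_{k_m}`. [cite: MochizukiEtTh2009, Def 3.3 p.73] -/
theorem levelActFn_inl (k : Kum 3) : levelActFn m (SemidirectProduct.inl k) = kumAct m k := by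
  rw [levelActFn, SemidirectProduct.lift_inl]

/-- A pure `(c, a)` acts by `C_{χ_m(c)} ∘ T_a`. [cite: MochizukiEtTh2009, Def 3.3 p.73] -/
theorem levelActFn_inr (q : Cst × Multiplicative ℤ) : levelActFn m (SemidirectProduct.inr q) = cstTranslAct m q := by
  rw [levelActFn, SemidirectProduct.lift_inr]

/-- `levelActFn g = K_{k_m} * (C_c * T_a)` for `g = ⟨k, (c, a)⟩`. [cite: MochizukiEtTh2009, Def 3.3 p.73] -/
theorem levelActFn_apply (g : Grp 3 thetaShear) :
    levelActFn m g = kumAct m g.left * (constAction (levelChar m g.right.1) * translAction (0 : ZMod (M m)) g.right.2) := rfl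

/-- **The skeleton part of `g · x` is the sign-fixed shear by the translation component of `g`** (the Kummer classes and the
constants only move roots of unity). [cite: MochizukiEtTh2009, Def 3.3 p.73] -/
theorem levelActFn_snd (g : Grp 3 thetaShear) (x : Fn (Multiplicative (ZMod (M m)))) :
    (levelActFn m g x).2 = shear₀Fn (Multiplicative.toAdd g.right.2) x.2 := rfl

/-- The translation quotient `«GRP₃′» → ℤ_γ`. [cite: MochizukiEtTh2009, Def 3.3 (ii) p.73] -/
def toTransl : Grp 3 thetaShear →* Multiplicative ℤ := (MonoidHom.snd Cst (Multiplicative ℤ)).comp SemidirectProduct.rightHom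

/-- `toTransl g = g.right.2`. [cite: MochizukiEtTh2009, Def 3.3 (ii) p.73] -/
@[simp] theorem toTransl_apply (g : Grp 3 thetaShear) : toTransl g = g.right.2 := rfl

variable [NeZero (M m)]

/-- **The Galois action of «GRP₃′» on the level `m` of the `Ÿ`-skeleton** — functions by `levelActFn`, log-divisors / cusps /
components by the translation quotient through the `Ÿ`-skeleton's `baseAction`; EVERY LAW PROVED (divisors shift with the
translation; constants and integral constants are preserved; multiplicities are permuted). [cite: MochizukiEtTh2009, Def 3.3 p.73] -/
def levelAction : (model (Multiplicative (ZMod (M m)))).GaloisAction (Grp 3 thetaShear) :=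
  { (translGaloisAction (0 : ZMod (M m))).comap toTransl with
    actFn := levelActFn m
    act_mem_logMero := fun _ _ _ => trivial
    act_mem_const := @fun g _ hf => ((translGaloisAction (0 : ZMod (M m))).comap toTransl).act_mem_const g hf
    act_mem_intConst := @fun g _ hf => ((translGaloisAction (0 : ZMod (M m))).comap toTransl).act_mem_intConst g hf
    divisor_act := fun g f => ((translGaloisAction (0 : ZMod (M m))).comap toTransl).divisor_act g f }

/-- The action on functions is `levelActFn`. [cite: MochizukiEtTh2009, Def 3.3 p.73] -/
theorem levelAction_actFn : (levelAction m).actFn = levelActFn m := rfl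

/-- The action on log-divisors is the `Ÿ`-skeleton's shift by the translation component. [cite: MochizukiEtTh2009, Def 3.3 p.73] -/
theorem levelAction_actDIV (g : Grp 3 thetaShear) :
    (levelAction m).actDIV g = TateTowerTheta.baseAction.actDIV g.right.2 := rfl

omit [NeZero (M m)] in
/-- **The deviation of design (β), kernel-visible**: the translation `a` sends the root `Θ̈_m` to `ϖ̈_m^{−a²} Ü_m^{2a} Θ̈_m` with
TRIVIAL root-of-unity factor — the sign `(−1)^a` of Prop. 1.4 (ii) is not carried at the levels.
[cite: MochizukiEtTh2009, Prop 1.4 p.22] -/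
theorem levelActFn_transl_theta (a : Multiplicative ℤ) :
    levelActFn m (SemidirectProduct.inr (1, a)) (theta (Multiplicative (ZMod (M m)))) =
      (1, Multiplicative.ofAdd (((0 : ZMod 2), -(Multiplicative.toAdd a * Multiplicative.toAdd a),
        2 * Multiplicative.toAdd a, (1 : ℤ)) : Exp)) := by
  rw [levelActFn_inr, cstTranslAct_apply, map_one, map_one, one_mul, translAction_apply, translAut_theta, smul_zero]
  rfl

omit [NeZero (M m)] in
/-- Whereas a Kummer element with `Θ̈`-class `k_m(Θ̈) = κ_Θ` multiplies `Θ̈_m` by the root of unity `ζ^{κ_Θ}` (all three classes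
act). [cite: MochizukiEtTh2009, §1 p.13] -/
theorem levelActFn_kum_theta (k : Kum 3) :
    levelActFn m (SemidirectProduct.inl k) (theta (Multiplicative (ZMod (M m)))) =
      (Multiplicative.ofAdd (Multiplicative.toAdd k m 2), TateTowerTheta.theta) := by
  rw [levelActFn_inl, kumAct_apply, kummerAut_theta]

end TateTowerThetaTwist

end LogDivisorModel

end Literature.AnabelianGeometry.EtaleTheta

end
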